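import Summits.HodgeConjecture.HodgeConjecture.Theses.TropicalWeilObstruction
import Summits.HodgeConjecture.HodgeConjecture.Theorems.TropicalWeilObstructionTropicalHodgeBoundHermitianPairing
import Summits.HodgeConjecture.HodgeConjecture.Theorems.TropicalWeilObstructionTropicalHodgeBoundThetaLine
import HarnessLib

/-!
# Route `TropicalWeilObstruction` (Kontsevich's tropical test — NEGATION SINK, exploration, no summit claim):
# `θ_n(Q)`, `Re w(Q)`, `Im w(Q)` are linearly independent; K1 ⟺ effective classes span at most the theta line

Negation-sink bookkeeping of the cell `pub-hodge-tropical` (seat tropical-2), companion of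
`…TropicalHodgeBoundClassesEigenwave` / `…TropicalHodgeBoundIntegralHodgeLattice` (the integral tropical Hodge
`(4,4)`-lattice of a Weil-generic `X_Q = ℝ⁸/Qℤ⁸` is `{a θ₄ + b Re w + c Im w : a, b, c ∈ ℤ}`).

* `linearIndependent_thetaClass_weilClasses` — for `Q ≻ 0`, `QJ = JQ`, any `n ≥ 1`, the tables `θ_n(Q)`, `Re w(Q)`,
  `Im w(Q)` are linearly independent over `ℝ` (apply `M̂ = dz ⊗ dz̄`: values `det(PQPᴴ) ≠ 0, 0, 0`, and `Ŵ = dz ⊗ dz`: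
  values `0, 2ⁿ⁻¹det(PQPᴴ), -i·2ⁿ⁻¹det(PQPᴴ)`, all from p331596); so that lattice is free of rank EXACTLY `3`, and
  `weilClassRe_not_mem_span_thetaClass`, `weilClassIm_not_mem_span_thetaClass`.
* `tropicalWeilVanishing_iff_span_cyc_le_thetaLine` — the open crux K1 (`TropicalWeilVanishing`, stmt-18478) holds
  iff at every Weil-generic period the real span of the classes of ALL effective tropical `4`-cycles lies in the
  line `ℝθ₄(Q)` (from `tropicalWeilVanishing_iff_real_thetaLine`, p329881) — a line missing `Re w(Q)` and `Im w(Q)`: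
  K1 says exactly that the tropical Hodge conjecture FAILS in bidegree `(4,4)` on the very general tropical Weil
  eightfold, with the Weil classes (two of the three lattice directions) non-effective. (Whether `θ₄(Q)` itself is
  effective at a Weil-generic `Q` — it is, by a simplicial refinement of the stable self-intersection `Θ⁴` — is not
  formalised: no effective cycle at a Weil-generic period is constructed in the tree.)
* `cyc_symm`, `cyc_eigenwave_symm` — a cycle class is a symmetric table, so the landed `cyc_eigenwave` (which moves a
  vector from the frame factor to the position factor) is also Zharkov's `φ(cyc Z) = 0`
  (`φ : ⋀ᵖΓ₁ ⊗ ⋀ᵖΓ₂ → ⋀ᵖ⁻¹Γ₁ ⊗ ⋀ᵖ⁺¹V` moves it the other way) [cite: Zharkov2020TropicalWeil, p. 1].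

HONEST STATUS. K1 is an OPEN problem and K2 (`MumfordWeilShadow`) is XL; nothing here decides either or bears on
the Hodge conjecture. No definition, no named fact, no sorry.
References: [Zharkov2020TropicalWeil] I. Zharkov, arXiv:2002.02347, pp. 1–2; [MikhalkinZharkov2014Eigenwave]
G. Mikhalkin, I. Zharkov, LN UMI 15 (2014), Prop. 4.3, Thm. 5.4.
-/

set_option linter.dupNamespace false

noncomputable section

open scoped BigOperators
open Matrix
open Literature.AlgebraicGeometry.Tropical

namespace Summit.HodgeConjecture.HodgeConjecture.Theorems.TropicalHodgeBound

/-! ## §0 Display-only notation (the K3 skeleton's local definitions, verbatim bodies; nothing is defined) -/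

/-- `P = [1 | i·1]`, the `n × 2n` matrix of `dz₁ ∧ … ∧ dz_n`. -/
local notation3 (prettyPrint := false) "𝐏⟦" n "⟧" =>
  (Matrix.of fun (k : Fin n) (a : Fin (2 * n)) =>
    (if (a : ℕ) = (k : ℕ) then (1 : ℂ) else 0) + (if (a : ℕ) = (k : ℕ) + n then Complex.I else 0))

/-- The skeleton's `dzCoord n S`. -/
local notation3 (prettyPrint := false) "dz⟦" n "⟧" S:max =>
  (Matrix.det (Matrix.of fun k a : Fin n =>
    (if (S a : ℕ) = (k : ℕ) then (1 : ℂ) else 0) + (if (S a : ℕ) = (k : ℕ) + n then Complex.I else 0)))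

/-- The skeleton's `weilPairing n C` (the value `Ŵ(C)` of `dz ⊗ dz`). -/
local notation3 (prettyPrint := false) "Ŵ⟦" n "⟧" C:max =>
  (∑ S : Fin n → Fin (2 * n), ∑ S' : Fin n → Fin (2 * n),
    dz⟦n⟧ S * dz⟦n⟧ S' / ((Nat.factorial n : ℂ) ^ 2) * ((C S S' : ℝ) : ℂ))

/-- The hermitian pairing `M̂(C)` (the value of `dz ⊗ dz̄` on `C`), as in `…HermitianPairing`. -/
local notation3 (prettyPrint := false) "M̂⟦" n "⟧" C:max =>
  (∑ S : Fin n → Fin (2 * n), ∑ S' : Fin n → Fin (2 * n),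
    dz⟦n⟧ S * (starRingEnd ℂ) (dz⟦n⟧ S') / ((Nat.factorial n : ℂ) ^ 2) * ((C S S' : ℝ) : ℂ))

/-- The skeleton's `thetaClass n Q`. -/
local notation3 (prettyPrint := false) "θ⟦" n "⟧" Q:max =>
  (fun S S' : Fin n → Fin (2 * n) => Matrix.det (Matrix.submatrix Q S S'))

/-- The skeleton's `omegaFrame n` (`Ω = Pᴴ`). -/
local notation3 (prettyPrint := false) "Ω⟦" n "⟧" =>
  (Matrix.of fun (a : Fin (2 * n)) (b : Fin n) =>
    (if (a : ℕ) = (b : ℕ) then (1 : ℂ) else 0) - (if (a : ℕ) = (b : ℕ) + n then Complex.I else 0))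

/-- The skeleton's `weilClassC n Q` (`w(Q) = (⋀ⁿQ ⊗ 1)(Ω ⊗ Ω)`). -/
local notation3 (prettyPrint := false) "wC⟦" n "⟧" Q:max =>
  (fun S S' : Fin n → Fin (2 * n) =>
    Matrix.det (Matrix.submatrix (Matrix.map Q ((↑) : ℝ → ℂ) * Ω⟦n⟧) S id) *
      Matrix.det (Matrix.submatrix (Ω⟦n⟧) S' id))

/-- The skeleton's `weilClassRe n Q` (`w₁ = Re w`). -/
local notation3 (prettyPrint := false) "wRe⟦" n "⟧" Q:max =>
  (fun S S' : Fin n → Fin (2 * n) => Complex.re ((wC⟦n⟧ Q) S S'))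

/-- The skeleton's `weilClassIm n Q` (`w₂ = Im w`). -/
local notation3 (prettyPrint := false) "wIm⟦" n "⟧" Q:max =>
  (fun S S' : Fin n → Fin (2 * n) => Complex.im ((wC⟦n⟧ Q) S S'))

/-! ## §1 The three classes are linearly independent over `ℝ` (any `n ≥ 1`) -/

section Independent

variable {n : ℕ}

/-- A linear functional `C ↦ Σ κ(S,S') C(S,S')` on a three-term combination. [folklore] -/
theorem sum_sum_mul_lincomb₃ {α : Type*} [Fintype α] (κ : α → α → ℂ) (a b c : ℝ) (X Y Z : α → α → ℝ) :
    ∑ S, ∑ S', κ S S' * (((a • X + b • Y + c • Z) S S' : ℝ) : ℂ) =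
      (a : ℂ) * ∑ S, ∑ S', κ S S' * ((X S S' : ℝ) : ℂ) +
        (b : ℂ) * ∑ S, ∑ S', κ S S' * ((Y S S' : ℝ) : ℂ) +
        (c : ℂ) * ∑ S, ∑ S', κ S S' * ((Z S S' : ℝ) : ℂ) := by
  simp only [Pi.add_apply, Pi.smul_apply, smul_eq_mul, Complex.ofReal_add, Complex.ofReal_mul,
    Finset.mul_sum, ← Finset.sum_add_distrib]
  refine Finset.sum_congr rfl fun S _ => Finset.sum_congr rfl fun S' _ => ?_
  ring

/-- **`θ_n(Q)`, `Re w(Q)`, `Im w(Q)` are linearly independent over `ℝ`** for `Q ≻ 0`, `QJ = JQ`, `n ≥ 1`: apply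
`M̂` (`M̂(θ) = det(PQPᴴ) ≠ 0`, `M̂(Re w) = M̂(Im w) = 0`) and `Ŵ` (`Ŵ(θ) = 0`, `Ŵ(Re w) = iŴ(Im w) = 2ⁿ⁻¹det(PQPᴴ)`).
[cite: Zharkov2020TropicalWeil, §2] -/
theorem linearIndependent_thetaClass_weilClasses (hn : 0 < n) (Q : Matrix (Fin (2 * n)) (Fin (2 * n)) ℝ)
    (hQ : Q.PosDef) (hJ : Q * weilJ n = weilJ n * Q) :
    LinearIndependent ℝ ![θ⟦n⟧ Q, wRe⟦n⟧ Q, wIm⟦n⟧ Q] := by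
  rw [Fintype.linearIndependent_iff]
  intro g hg
  have hsum : g 0 • θ⟦n⟧ Q + g 1 • wRe⟦n⟧ Q + g 2 • wIm⟦n⟧ Q = 0 := by
    simpa [Fin.sum_univ_three] using hg
  have hD := det_frame_mul_map_mul_conjTranspose_ne_zero Q hQ
  -- apply `M̂`
  have hM := sum_sum_mul_lincomb₃
    (fun S S' : Fin n → Fin (2 * n) => dz⟦n⟧ S * (starRingEnd ℂ) (dz⟦n⟧ S') / ((Nat.factorial n : ℂ) ^ 2))
    (g 0) (g 1) (g 2) (θ⟦n⟧ Q) (wRe⟦n⟧ Q) (wIm⟦n⟧ Q)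
  rw [hsum] at hM
  beta_reduce at hM
  rw [hermPairing_thetaClass_eq_det Q, hermPairing_weilClassRe_eq_zero hn Q hJ,
    hermPairing_weilClassIm_eq_zero hn Q hJ] at hM
  simp only [Pi.zero_apply, Complex.ofReal_zero, mul_zero, Finset.sum_const_zero, add_zero] at hM
  have hg0 : g 0 = 0 := by
    have := mul_eq_zero.mp hM.symm
    rcases this with h | h
    · exact_mod_cast h
    · exact absurd h hD
  -- apply `Ŵ`
  have hW := sum_sum_mul_lincomb₃
    (fun S S' : Fin n → Fin (2 * n) => dz⟦n⟧ S * dz⟦n⟧ S' / ((Nat.factorial n : ℂ) ^ 2))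
    (g 0) (g 1) (g 2) (θ⟦n⟧ Q) (wRe⟦n⟧ Q) (wIm⟦n⟧ Q)
  rw [hsum] at hW
  beta_reduce at hW
  rw [weilPairing_thetaClass_eq_zero hn Q hJ, weilPairing_weilClassRe_eq hn Q, weilPairing_weilClassIm_eq hn Q]
    at hW
  simp only [Pi.zero_apply, Complex.ofReal_zero, mul_zero, Finset.sum_const_zero] at hW
  have h2 : (2 : ℂ) ^ (n - 1) ≠ 0 := pow_ne_zero _ two_ne_zero
  have hW' : ((g 1 : ℂ) - (g 2 : ℂ) * Complex.I) * ((2 : ℂ) ^ (n - 1) *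
      (𝐏⟦n⟧ * Q.map ((↑) : ℝ → ℂ) * (𝐏⟦n⟧)ᴴ).det) = 0 := by
    linear_combination -hW
  have hW'' : (g 1 : ℂ) - (g 2 : ℂ) * Complex.I = 0 :=
    (mul_eq_zero.mp hW').resolve_right (mul_ne_zero h2 hD)
  have hre := congrArg Complex.re hW''
  have him := congrArg Complex.im hW''
  simp only [Complex.sub_re, Complex.ofReal_re, Complex.mul_re, Complex.I_re, mul_zero, Complex.ofReal_im,
    Complex.I_im, mul_one, sub_self, sub_zero, Complex.zero_re, Complex.sub_im, Complex.mul_im, add_zero,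
    Complex.zero_im, zero_sub, neg_eq_zero] at hre him
  intro i
  fin_cases i
  · exact hg0
  · exact hre
  · exact him

/-- **`Re w(Q)` is not on the real theta line** (`Q ≻ 0`, `QJ = JQ`, `n ≥ 1`). [cite: Zharkov2020TropicalWeil, §2] -/
theorem weilClassRe_not_mem_span_thetaClass (hn : 0 < n) (Q : Matrix (Fin (2 * n)) (Fin (2 * n)) ℝ)
    (hQ : Q.PosDef) (hJ : Q * weilJ n = weilJ n * Q) :
    wRe⟦n⟧ Q ∉ Submodule.span ℝ {θ⟦n⟧ Q} := by
  intro h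
  obtain ⟨r, hr⟩ := Submodule.mem_span_singleton.mp h
  have hli := linearIndependent_thetaClass_weilClasses hn Q hQ hJ
  rw [Fintype.linearIndependent_iff] at hli
  have := hli ![r, -1, 0] (by simp [Fin.sum_univ_three, hr]) 1
  simp at this

/-- **`Im w(Q)` is not on the real theta line** (`Q ≻ 0`, `QJ = JQ`, `n ≥ 1`). [cite: Zharkov2020TropicalWeil, §2] -/
theorem weilClassIm_not_mem_span_thetaClass (hn : 0 < n) (Q : Matrix (Fin (2 * n)) (Fin (2 * n)) ℝ)
    (hQ : Q.PosDef) (hJ : Q * weilJ n = weilJ n * Q) :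
    wIm⟦n⟧ Q ∉ Submodule.span ℝ {θ⟦n⟧ Q} := by
  intro h
  obtain ⟨r, hr⟩ := Submodule.mem_span_singleton.mp h
  have hli := linearIndependent_thetaClass_weilClasses hn Q hQ hJ
  rw [Fintype.linearIndependent_iff] at hli
  have := hli ![r, 0, -1] (by simp [Fin.sum_univ_three, hr]) 2
  simp at this

end Independent

/-! ## §2 What the open crux K1 says, in these terms -/

/-- **K1 ⟺ effective classes span at most the theta line.** `TropicalWeilVanishing` holds iff at every
Weil-generic period `Q ≻ 0`, `QJ = JQ`, the real span of the classes of ALL effective tropical `4`-cycles on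
`X_Q = ℝ⁸/Qℤ⁸` is contained in `ℝ·θ₄(Q)` (from `tropicalWeilVanishing_iff_real_thetaLine`, p329881). Since the
integral Hodge lattice there is `ℤθ₄ ⊕ ℤ Re w ⊕ ℤ Im w` (`integralHodgeClass_iff`, sibling file `…IntegralHodgeLattice`) and `Re w, Im w ∉ ℝθ₄`
(`weilClassRe_not_mem_span_thetaClass`, `weilClassIm_not_mem_span_thetaClass`), K1 is exactly the statement that
the tropical Hodge conjecture FAILS in bidegree `(4,4)` on the very general tropical Weil eightfold, with the Weil
classes non-effective. An OPEN problem; nothing here is evidence for it, and nothing here bears on HC.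
[cite: Zharkov2020TropicalWeil, pp. 1–2] -/
theorem tropicalWeilVanishing_iff_span_cyc_le_thetaLine :
    Summit.HodgeConjecture.HodgeConjecture.Theses.TropicalWeilObstruction.TropicalWeilVanishing ↔
      ∀ Q : Matrix (Fin (2 * 4)) (Fin (2 * 4)) ℝ, Q.PosDef → Q * weilJ 4 = weilJ 4 * Q →
        IsWeilGeneric 4 Q →
          Submodule.span ℝ (Set.range fun Z : TropicalTorusCycle (2 * 4) 4 Q => Z.cyc) ≤
            Submodule.span ℝ {θ⟦4⟧ Q} := by
  rw [tropicalWeilVanishing_iff_real_thetaLine]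
  refine forall_congr' fun Q => forall_congr' fun hQ => forall_congr' fun hJ => forall_congr' fun hgen => ?_
  rw [Submodule.span_le, Set.range_subset_iff]
  refine forall_congr' fun Z => ?_
  rw [SetLike.mem_coe, Submodule.mem_span_singleton]
  constructor
  · rintro ⟨r, hr⟩; exact ⟨r, hr.symm⟩
  · rintro ⟨r, hr⟩; exact ⟨r, hr.symm⟩

/-! ## §3 Zharkov's direction of the eigenwave

The landed `cyc_eigenwave` moves a vector from the frame factor into the position factor; Zharkov's
`φ : ⋀ᵖΓ₁ ⊗ ⋀ᵖΓ₂ → ⋀ᵖ⁻¹Γ₁ ⊗ ⋀ᵖ⁺¹V` moves it the other way. A cycle class is a SYMMETRIC table, so it is killed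
by both (likewise `θ₄(Q)`, `w(Q)`: `thetaClass_symm`, `weilClassC_symm` in `…ClassesEigenwave`). -/

section Direction

variable {g p : ℕ} {Q : Matrix (Fin g) (Fin g) ℝ}

/-- The cycle class is a symmetric table: `cyc Z S S' = cyc Z S' S` (both factors are Plücker coordinates of
the same frame). [cite: MikhalkinZharkov2014Eigenwave, Prop. 4.3] -/
theorem cyc_symm (Z : TropicalTorusCycle g p Q) (S S' : Fin p → Fin g) : Z.cyc S S' = Z.cyc S' S := by
  unfold TropicalTorusCycle.cyc
  refine Finset.sum_congr rfl fun σ _ => ?_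
  ring

/-- **Tropical cycle classes are killed by the eigenwave in Zharkov's direction** (contract the position
factor, wedge into the frame factor): `Σ_m (-1)^m · cyc Z (K'_m :: J') (K' ∘ m̂) = 0`.
[cite: Zharkov2020TropicalWeil, p. 1] [cite: MikhalkinZharkov2014Eigenwave, Thm. 5.4] -/
theorem cyc_eigenwave_symm (Z : TropicalTorusCycle g 4 Q) (K' : Fin 5 → Fin g) (J' : Fin 3 → Fin g) :
    ∑ m : Fin 5, (-1 : ℝ) ^ (m : ℕ) *
      Z.cyc (Fin.cons (K' m) J') (fun a => K' (m.succAbove a)) = 0 := by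
  simp_rw [cyc_symm Z (Fin.cons _ _)]
  exact cyc_eigenwave Z K' J'

end Direction

end Summit.HodgeConjecture.HodgeConjecture.Theorems.TropicalHodgeBound

end
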